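import Summits.CriticalPhenomena.PercolationContinuityZ3.Theorems.Transplant.FKDoubleFanBlocks
import Summits.CriticalPhenomena.PercolationContinuityZ3.Theorems.Transplant.FKDoubleFanMultifanGens
import HarnessLib

/-!
# Double fans `K₂ ∨ P_{m+1}`: the `∧²V₃`-block of the TWISTED pairing `Q(β, γ) = ⟪β, σγ⟫` is non-negative on `C3 × C3` — an explicit identity

Helper file (`--supports stmt-CriticalPhenomena-4575`), FK sub-lane `prim-bschramm-fk-3` (gen 44); builds on p205010 (kernel theorem, internal
audit signed; external expert review pending).  Pure real algebra; no named facts, no sorries; standard axioms.  Memo `bschramm/prim-bschramm-fk-3/FAR-CROSS-XIX.md` §1.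

The far cross-apex Rayleigh difference of a word `W = W₂W₁` is the twisted pairing `Q(g, g') = ⟪g, σ g'⟫_H` of the two half-word images
`g = ∧²W₁ ι_a(u)`, `g' = ∧²(σW₂^{rev}) ι_a(s̃)` (`σ` = the mirror `y ↔ z`, `Biv.swapYZ`); in particular MULTIFAN₁ is `Q ≥ 0` on `R_A × R_A` and
LEMMA‴-BA (the minimal open class of middles: a `b`-fan followed by an `a`-fan) is `Q ≥ 0` on `R_B × R_B`.  By the block decomposition of
`…DoubleFanBlocks`, `Q = Q₃₃ + Q₃₂ + Q₂₂` with `Q₂₂ = p·β_xv γ_xv ≥ 0`.  This file settles the `∧²V₃`-part for EVERY pair of letter-cone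
elements by an explicit identity (**`pairH33_swapYZ_eq`**):
`Q₃₃(β,γ)/p² = (1+p)(β_uy γ_uz + β_uz γ_uy) + β_yz γ_yz = (1+p)q·β_uz γ_uz + ℓ₄(β)ℓ₄(γ) + (1+p)(ℓ₃(β)·(−γ_uz) + ℓ₃(γ)·(−β_uz))`
with the `C3` facet functionals `ℓ₃ = −uy + uz − yz ≥ 0`, `ℓ₄ = (2−q)uz − yz ≥ 0` and `uz ≤ 0`; hence (**`pairH33_swapYZ_nonneg`**) `Q₃₃ ≥ 0` on
`C3 × C3` (`0 ≤ q ≤ 1`), and (**`pairH33_swapYZ_midWord_nonneg`**) the `∧²V₃`-part of `Q` of ANY two double-fan word images is `≥ 0` — the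
symmetric form of `pairH33_crossFar_nonneg`, covering in particular the `∧²V₃`-third of LEMMA‴-BA.  The mixed block remains.
[folklore]
-/

noncomputable section

namespace Summit.CriticalPhenomena.PercolationContinuityZ3.Theorems

namespace FK

namespace ThreeApex

/-- The `∧²V₃`-part of the twisted pairing: `pairH33 q β (σγ) = p²[(1+p)(β_uy γ_uz + β_uz γ_uy) + β_yz γ_yz]`, and its decomposition into
products of `C3` facet functionals. [folklore] -/
theorem pairH33_swapYZ_eq (q : ℝ) (β γ : Biv) :
    pairH33 q β (Biv.swapYZ γ) =
      (1 - q) ^ 2 * ((2 - q) * q * (β.uz * γ.uz) + ((2 - q) * β.uz - β.yz) * ((2 - q) * γ.uz - γ.yz)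
        + (2 - q) * ((-β.uy + β.uz - β.yz) * (-γ.uz) + (-γ.uy + γ.uz - γ.yz) * (-β.uz))) := by
  simp only [pairH33, Biv.swapYZ]; ring

/-- **`Q₃₃ ≥ 0` on `C3 × C3`** (`0 ≤ q ≤ 1`): the `∧²V₃`-part of the twisted pairing of any two elements of the polyhedral letter cone is
non-negative. [folklore] -/
theorem pairH33_swapYZ_nonneg {q : ℝ} (hq0 : 0 ≤ q) (hq1 : q ≤ 1) {β γ : Biv} (hβ : C3 q β) (hγ : C3 q γ) :
    0 ≤ pairH33 q β (Biv.swapYZ γ) := by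
  obtain ⟨b1, b2, b3, b4⟩ := hβ
  obtain ⟨c1, c2, c3, c4⟩ := hγ
  rw [pairH33_swapYZ_eq]
  have hr : 0 ≤ 2 - q := by linarith
  have h3 : 0 ≤ -β.uy + β.uz - β.yz := by linarith
  have h3' : 0 ≤ -γ.uy + γ.uz - γ.yz := by linarith
  have t1 : 0 ≤ (2 - q) * q * (β.uz * γ.uz) := mul_nonneg (mul_nonneg hr hq0) (mul_nonneg_of_nonpos_of_nonpos b2 c2)
  have t2 : 0 ≤ ((2 - q) * β.uz - β.yz) * ((2 - q) * γ.uz - γ.yz) := mul_nonneg b4 c4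
  have t3 : 0 ≤ (2 - q) * ((-β.uy + β.uz - β.yz) * (-γ.uz) + (-γ.uy + γ.uz - γ.yz) * (-β.uz)) :=
    mul_nonneg hr (add_nonneg (mul_nonneg h3 (by linarith)) (mul_nonneg h3' (by linarith)))
  exact mul_nonneg (sq_nonneg _) (by linarith)

/-- **The `∧²V₃`-part of the twisted pairing of ANY two double-fan word images is non-negative** (`0 ≤ q ≤ 1`; inputs with non-negative masses,
block weights and last rim weights in `[0,1]`) — the `∧²V₃`-third of the far cross-apex inequality for every split of every middle, in
particular of LEMMA‴-BA. [folklore] -/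
theorem pairH33_swapYZ_midWord_nonneg {q : ℝ} (hq0 : 0 ≤ q) (hq1 : q ≤ 1) {m₁ m₂ : List (ℝ × ℝ × ℝ)} (h₁ : UnitBlocks m₁)
    (h₂ : UnitBlocks m₂) {r₁ r₂ : ℝ} (hr₁0 : 0 ≤ r₁) (hr₁1 : r₁ ≤ 1) (hr₂0 : 0 ≤ r₂) (hr₂1 : r₂ ≤ 1) {u s : V5} (hu : u.Nonneg) (hs : s.Nonneg) :
    0 ≤ pairH33 q (wedgeH (rimStep q r₁ (midWord q m₁ (conv (edgeAC 0) u))) (rimStep q r₁ (midWord q m₁ (conv (edgeAC 1) u))))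
      (Biv.swapYZ (wedgeH (rimStep q r₂ (midWord q m₂ (conv (edgeAC 0) s))) (rimStep q r₂ (midWord q m₂ (conv (edgeAC 1) s))))) :=
  pairH33_swapYZ_nonneg hq0 hq1 (C3.midWord hq0 hq1 h₁ hr₁0 hr₁1 hu) (C3.midWord hq0 hq1 h₂ hr₂0 hr₂1 hs)

end ThreeApex

end FK

end Summit.CriticalPhenomena.PercolationContinuityZ3.Theorems
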